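import Summits.QuantumFields.YangMills.Theorems.AlphaInputsT3ACv3EMLIterFirstOrderUniform
import HarnessLib

/-!
# `AlphaInputsT3ACv3EMLIterFirstOrderUniformLgeD` — [Balaban1985Averaging] PROP. 4 (134)–(135) AT THE FLAT BACKGROUND, `k`-UNIFORM, **FOR EVERY BLOCK SIZE `L ≥ d`** (so for every
# odd `L ≥ 3` at `d = 3`), IN THE EXACT SHAPE OF ✓`EMLIterUniform.norm_iter_sub_one_sub_iterLin_le_uniform` (same main scale `m_s = 2|n|²(d+1)L^s·δ`, same two windows, no
# level-range hypothesis) with its `hL : d + 2 ≤ L` replaced by `hLd : d ≤ L` — a DROP-IN engine for the (69)_sym ∕ (71)_sym seam chain typed against that theorem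
# (✓`…SymAvgPlaqAssembly` §3, ✓`…SymAvgGaugeClamp`, ✓`…SymAvgSixtyNine(T3)`, ✓`…v4SmallFactor71OfRec`, all carrying `5 ≤ F.L` = L-FLOOR LF-2 of ★★OWNER RULING g26-№20) —
# cell `ym3-torus`, crux stmt-QuantumFields-19936, LEAD seat `ym-ust-19936-w1` (g3); plan `SEAM-L3-REPAIR-PLAN-w1-g3.md`

PRIOR ART (read first).  ★w5-19936 g0's ✓`Theorems/AlphaInputsT3ACv3EMLIterFirstOrderUniformAllL` (`EMLIterUniformAllL.norm_iter_sub_one_sub_iterLin_le_uniform_allL`, 2026-08-28T01:31Z)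
ALREADY removes the floor for every `L ≥ 2`, by a Duhamel sum through the sup-small exact lift `liftS` (main scale `(d+1)L^s·δ` without the `|n|²` factor, level range `k ≤ m + K`,
a third window `32ℓ·m_k ≤ 1`, constant `(d+1)·18^d(2+(d+1)18^d)·324ℓ²∕(L(L−1))`).  The present file is NOT a replacement of it: it is the `R1`-shaped variant (identical
binders and conclusion shape, so the seam chain's `_allL` twins are one-token edits `hL ↦ hLd` plus the constant `324·L·(d+2)² ↦ 2|n|²(2d+1)·324ℓ²`), proved by a different,
lift-free bookkeeping; either theorem closes LF-2 at `d = 3`.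

WHY.  The g0 proof carries the second-order remainder `D_s = Ū^{(s)} − 1 − Q^{(s)}Y` by the step recursion `‖D_{s+1}‖ ≤ (d+1)L·‖D_s‖ + 324ℓ²m_s²` (one-step sup norm of the linearised
average, `norm_linAvg_le_sharp`), whose closed form `C·m_s²` survives a step only if `L > d + 1` (`step_dominates`).  The iterated LINEAR average is much better than its one-step norm
iterated: `Q₁ = M − d∘Φ` (segment mean minus the coboundary of the staircase potential, ✓`linAvg04_eq`), `M(dg) = d(ptMean g)` (✓`segMean_dgrad`), so a remainder kept in POTENTIAL
FORM `D_s = S_s − dΦ_s` (per real coordinate) evolves by `S_{s+1} = M S_s + E_{s+1}`, `Φ_{s+1} = ptMean Φ_s + Φ(D_s)` with one-step norms `L` (segment), `1` (point mean) and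
`d(L−1)∕2` (staircase) — and the closed forms `|S_s| ≤ A·m_s²`, `|Φ_s| ≤ B·m_s²` (`A = 324ℓ²`, `B = d·A`) survive a step as soon as `L ≥ max(2, d)`: `L·A + 324ℓ² ≤ A·L²` and
`B + ½d(L−1)(A + 2B) ≤ B·L²`.  This is print's own transport of the one-step errors by the linearised averaging operators ((130)–(133) p.38), read without the `(d+1)L` shortcut.
WHAT (def-free; same letters and namespace as the g0 file).  §1 the two closure inequalities `sigma_step`, `phi_step` and the entrywise norm assembly `norm_le_of_coord_abs_le`; §2 ★★
`norm_iter_sub_one_sub_iterLin_le_uniform_dL` — the statement of ✓`norm_iter_sub_one_sub_iterLin_le_uniform` with `hL : d + 2 ≤ L` replaced by `hLd : d ≤ L`, constant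
`C′ = 2|n|²·(2d+1)·324ℓ²` in place of `324L(d+2)²` (windows `C′·m_k ≤ 1`, `4ℓ·m_k < δ_N`): for every `s ≤ k`, `‖Ū^{(s)}(c) − 1‖ ≤ 2m_s` and `‖Ū^{(s)}(c) − 1 − (Q^{(s)}Y)(c)‖ ≤ C′·m_s²`.
HONEST FRAMING.  Flat background; elementary bookkeeping over landed one-step lemmas; nothing of [B10]∕[B11] asserted; the (69)_sym∕(71)_sym consumers need `_allL` twins to USE this (separate
files); the stub 2′χ, the crux and any gap are NOT claimed; count-neutral helper (`--supports stmt-QuantumFields-19936`).  YM₃ on the three-torus is rung R3 of the programme, NOT the Clay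
problem: nothing here bears on d = 4, infinite volume, or a mass gap.

References: T. Bałaban, Commun. Math. Phys. 98 (1985) 17–51 [Balaban1985Averaging] (Prop. 3 (122)–(123) p.36, (127)–(133) pp.37–38, Prop. 4 (134)–(135) p.38); CMP 109 (1987) 249–301
[Balaban1987RG1] ((0.3)–(0.4), (0.11) pp.252–253).
-/

set_option autoImplicit false

noncomputable section

namespace Summit.QuantumFields.YangMills.Theorems.EMLIterUniform

open Finset
open scoped Matrix.Norms.L2Operator
open Literature.MathematicalPhysics.QuantumFieldTheory.Balaban1983to89
open T4Continuum AveragingRT BlockAveraging ExpMeanLog BlockAveragingEMLLinearised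
open Summit.QuantumFields.YangMills.Theorems.AbelianEML (segMean stairMean linAvg04 linAvg04_eq)
open Summit.QuantumFields.YangMills.Theorems.LinearLiftGauge (dgrad ptMean segMean_dgrad segMean_sub)
open Summit.QuantumFields.YangMills.Theorems.Prop7LinAvgOnto (linAvg_add)
open Summit.QuantumFields.YangMills.Theorems.Prop7AvgLinearisation (iter_zero_apply' iter_succ_eq_avgFun')
open Summit.QuantumFields.YangMills.Theorems.LinearAvgSup (cast_half_eq abs_segMean_le abs_stairMean_le abs_ptMean_le abs_dgrad_le)
open Summit.QuantumFields.YangMills.Theorems.LinearAvgMatrix (norm_iterLin_le apply_linAvg abs_re_im_entry_le_norm norm_le_sum_abs_re_add_abs_im reLm_comp_entry_apply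
  imLm_comp_entry_apply)

variable {P : Params} {j : ℕ} {n : Type*} [Fintype n] [DecidableEq n] [Nonempty n]

/-! ## §1 The closure inequalities of the potential-form recursion and the entrywise norm assembly -/

/-- **SEGMENT STEP**: with `A = 324ℓ²` and `L ≥ 2`, `L·(A·x) + 324ℓ²·x ≤ A·(L²·x)` for `x ≥ 0` (the segment mean has one-step norm `L`; the new one-step error is `324ℓ²·m_s²`).
[cite: Balaban1985Averaging, (132)–(133) p.38] -/
theorem sigma_step {L ℓ x : ℝ} (hL : 2 ≤ L) (hx : 0 ≤ x) :
    L * (324 * ℓ ^ 2 * x) + 324 * ℓ ^ 2 * x ≤ 324 * ℓ ^ 2 * (L ^ 2 * x) := by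
  have h1 : L + 1 ≤ L ^ 2 := by nlinarith
  have h0 : 0 ≤ 324 * ℓ ^ 2 * x := by positivity
  nlinarith [mul_le_mul_of_nonneg_left h1 h0]

/-- **POTENTIAL STEP**: with `A = 324ℓ²`, `B = d·A`, `c = d(L−1)∕2` (the staircase norm), `d ≤ L` and `L ≥ 2`: `B·x + c·(A·x + 2·(B·x)) ≤ B·(L²·x)` for `x ≥ 0`.
[cite: Balaban1985Averaging, (132)–(133) p.38] -/
theorem phi_step {L d ℓ x : ℝ} (hL : 2 ≤ L) (hd0 : 0 ≤ d) (hdL : d ≤ L) (hx : 0 ≤ x) :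
    d * (324 * ℓ ^ 2) * x + d * ((L - 1) / 2) * (324 * ℓ ^ 2 * x + 2 * (d * (324 * ℓ ^ 2) * x)) ≤ d * (324 * ℓ ^ 2) * (L ^ 2 * x) := by
  -- divide by `d·A·x ≥ 0`: `1 + (L−1)∕2 + d(L−1) ≤ L²`, true for `d ≤ L`, `L ≥ 1`
  have hkey : 1 + (L - 1) / 2 + d * (L - 1) ≤ L ^ 2 := by nlinarith
  have h0 : 0 ≤ d * (324 * ℓ ^ 2) * x := by positivity
  have := mul_le_mul_of_nonneg_left hkey h0
  nlinarith [this]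

omit [Nonempty n] in
/-- **ENTRYWISE ASSEMBLY**: if every real coordinate `Re M_{ij}`, `Im M_{ij}` is `≤ R` in absolute value then `‖M‖ ≤ 2|n|²·R` (`ℓ² ≤ ℓ¹`, `norm_le_sum_abs_re_add_abs_im`). [folklore] -/
theorem norm_le_of_coord_abs_le (M : Matrix n n ℂ) {R : ℝ} (hre : ∀ i l, |(M i l).re| ≤ R) (him : ∀ i l, |(M i l).im| ≤ R) :
    ‖M‖ ≤ 2 * (Fintype.card n : ℝ) ^ 2 * R := by
  refine (norm_le_sum_abs_re_add_abs_im M).trans ?_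
  calc ∑ i, ∑ l, (|(M i l).re| + |(M i l).im|) ≤ ∑ _i : n, ∑ _l : n, (R + R) :=
        sum_le_sum fun i _ => sum_le_sum fun l _ => add_le_add (hre i l) (him i l)
    _ = 2 * (Fintype.card n : ℝ) ^ 2 * R := by
        rw [sum_const, sum_const, card_univ, nsmul_eq_mul, nsmul_eq_mul]; ring

/-! ## §2 Proposition 4 at the flat background, `k`-uniform, every `L ≥ d` -/

/-- **★★ [Balaban1985Averaging] PROP. 4 (134)–(135) AT THE FLAT BACKGROUND, `k`-UNIFORM, FOR EVERY `L ≥ max(2, d)`.**  Same letters as ✓`norm_iter_sub_one_sub_iterLin_le_uniform`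
(`Q 0 Y = Y`, `Q (s+1) Y c = linAvg (Q s Y) c`; `m_s = 2|n|²(d+1)L^sδ`, `ℓ = (d+2)L`), with `d ≤ L` INSTEAD OF `d + 2 ≤ L` and the constant `C′ = 2|n|²(2d+1)·324ℓ²`: if `C′·m_k ≤ 1` and
`4ℓ·m_k < δ_N` then for every `s ≤ k` and every level-`s` bond `c`, `‖Ū^{(s)}(c) − 1‖ ≤ 2m_s` and `‖Ū^{(s)}(c) − 1 − (Q^{(s)}Y)(c)‖ ≤ C′·m_s²`.  Proof: every real coordinate `φ∘D_s` of the
remainder is kept in potential form `S_s − dΦ_s` with `|S_s| ≤ 324ℓ²·m_s²`, `|Φ_s| ≤ d·324ℓ²·m_s²` (§1), and `‖D_s‖ ≤ 2|n|²·(1+2d)·324ℓ²·m_s²` by the entrywise assembly.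
[cite: Balaban1985Averaging, Prop. 4 (134)–(135) p.38, (127)–(133) pp.37–38; Balaban1987RG1, (0.4)+(0.11) p.253] -/
theorem norm_iter_sub_one_sub_iterLin_le_uniform_dL
    (Q : (i : ℕ) → (PBond P 0 → Matrix n n ℂ) → PBond P i → Matrix n n ℂ)
    (hQ0 : ∀ Y, Q 0 Y = Y) (hQs : ∀ (i : ℕ) (Y : PBond P 0 → Matrix n n ℂ) (c : PBond P (i + 1)), Q (i + 1) Y c = linAvg (Q i Y) c)
    (hLd : P.d ≤ P.L) (U : GaugeField P 0 (Matrix.specialUnitaryGroup n ℂ)) {δ : ℝ} (hδ : 0 ≤ δ)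
    (hU : ∀ b, ‖((U b : Matrix.specialUnitaryGroup n ℂ) : Matrix n n ℂ) - 1‖ ≤ δ) (k : ℕ)
    (hm : 2 * (Fintype.card n : ℝ) ^ 2 * (2 * (P.d : ℝ) + 1) * (324 * (((P.d + 2) * P.L : ℕ) : ℝ) ^ 2) *
      (2 * (Fintype.card n : ℝ) ^ 2 * (((P.d : ℝ) + 1) * (P.L : ℝ) ^ k * δ)) ≤ 1)
    (hN : 4 * (((P.d + 2) * P.L : ℕ) : ℝ) * (2 * (Fintype.card n : ℝ) ^ 2 * (((P.d : ℝ) + 1) * (P.L : ℝ) ^ k * δ)) < deltaSU n) :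
    ∀ s : ℕ, s ≤ k → ∀ c : PBond P s,
      ‖((Averaging.iter (fun i => blockAvg (P := P) (j := i) (expMeanLogSU (n := n))) s U c : Matrix.specialUnitaryGroup n ℂ) : Matrix n n ℂ) - 1‖ ≤
          2 * (2 * (Fintype.card n : ℝ) ^ 2 * (((P.d : ℝ) + 1) * (P.L : ℝ) ^ s * δ)) ∧
      ‖((Averaging.iter (fun i => blockAvg (P := P) (j := i) (expMeanLogSU (n := n))) s U c : Matrix.specialUnitaryGroup n ℂ) : Matrix n n ℂ) - 1 -
          Q s (fun b => ((U b : Matrix.specialUnitaryGroup n ℂ) : Matrix n n ℂ) - 1) c‖ ≤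
        2 * (Fintype.card n : ℝ) ^ 2 * (2 * (P.d : ℝ) + 1) * (324 * (((P.d + 2) * P.L : ℕ) : ℝ) ^ 2) *
          (2 * (Fintype.card n : ℝ) ^ 2 * (((P.d : ℝ) + 1) * (P.L : ℝ) ^ s * δ)) ^ 2 := by
  -- letters
  set ℓ : ℝ := (((P.d + 2) * P.L : ℕ) : ℝ) with hℓ
  set A : ℝ := 324 * ℓ ^ 2 with hA
  set B : ℝ := (P.d : ℝ) * (324 * ℓ ^ 2) with hB
  set C : ℝ := 2 * (Fintype.card n : ℝ) ^ 2 * (2 * (P.d : ℝ) + 1) * (324 * ℓ ^ 2) with hC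
  set Y : PBond P 0 → Matrix n n ℂ := fun b => ((U b : Matrix.specialUnitaryGroup n ℂ) : Matrix n n ℂ) - 1 with hY
  let m : ℕ → ℝ := fun s => 2 * (Fintype.card n : ℝ) ^ 2 * (((P.d : ℝ) + 1) * (P.L : ℝ) ^ s * δ)
  have hm_def : ∀ s, m s = 2 * (Fintype.card n : ℝ) ^ 2 * (((P.d : ℝ) + 1) * (P.L : ℝ) ^ s * δ) := fun s => rfl
  -- the `s`-fold average and its remainder
  let W : (s : ℕ) → GaugeField P s (Matrix.specialUnitaryGroup n ℂ) := fun s => Averaging.iter (fun i => blockAvg (P := P) (j := i) (expMeanLogSU (n := n))) s U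
  let D : (s : ℕ) → PBond P s → Matrix n n ℂ := fun s b => ((W s b : Matrix.specialUnitaryGroup n ℂ) : Matrix n n ℂ) - 1 - Q s Y b
  have hD_def : ∀ s b, D s b = ((W s b : Matrix.specialUnitaryGroup n ℂ) : Matrix n n ℂ) - 1 - Q s Y b := fun s b => rfl
  have hL0 : (0 : ℝ) ≤ P.L := Nat.cast_nonneg _
  have hL2 : (2 : ℝ) ≤ P.L := by exact_mod_cast P.hL.2
  have hd0 : (0 : ℝ) ≤ P.d := Nat.cast_nonneg _
  have hdL : (P.d : ℝ) ≤ P.L := by exact_mod_cast hLd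
  have hℓ0 : 0 ≤ ℓ := by rw [hℓ]; exact Nat.cast_nonneg _
  have hℓeq : ℓ = ((P.d : ℝ) + 2) * P.L := by rw [hℓ]; push_cast; ring
  have hA0 : 0 ≤ A := by positivity
  have hB0 : 0 ≤ B := by positivity
  have hC0 : 0 ≤ C := by positivity
  have hCAB : C = 2 * (Fintype.card n : ℝ) ^ 2 * (A + 2 * B) := by rw [hC, hA, hB]; ring
  have hm0 : ∀ s, 0 ≤ m s := fun s => by rw [hm_def]; positivity
  have hmsucc : ∀ s, m (s + 1) = (P.L : ℝ) * m s := fun s => by rw [hm_def, hm_def, pow_succ]; ring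
  have hmsq : ∀ s, (m (s + 1)) ^ 2 = (P.L : ℝ) ^ 2 * (m s) ^ 2 := fun s => by rw [hmsucc]; ring
  have hmono : ∀ s, s ≤ k → m s ≤ m k := fun s hs => main_scale_mono (n := n) hδ hs
  have hYδ : ∀ b, ‖Y b‖ ≤ δ := hU
  -- the main term on its natural scale
  have hmain : ∀ (s : ℕ) (c : PBond P s), ‖Q s Y c‖ ≤ m s := fun s c => norm_iterLin_le Q hQ0 hQs Y hYδ s c
  -- the staircase norm
  have hstair : ((P.d * ((P.L - 1) / 2) : ℕ) : ℝ) = (P.d : ℝ) * (((P.L : ℝ) - 1) / 2) := by push_cast; rw [cast_half_eq]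
  -- the induction: norm bound + potential form of every bounded real coordinate
  have key : ∀ s : ℕ, s ≤ k →
      (∀ c : PBond P s, ‖D s c‖ ≤ C * (m s) ^ 2) ∧
      ∀ (φ : Matrix n n ℂ →ₗ[ℝ] ℝ), (∀ M : Matrix n n ℂ, |φ M| ≤ ‖M‖) →
        ∃ (S : PBond P s → ℝ) (Φ : Site P s → ℝ),
          (∀ b, φ (D s b) = S b - dgrad Φ b) ∧ (∀ b, |S b| ≤ A * (m s) ^ 2) ∧ (∀ y, |Φ y| ≤ B * (m s) ^ 2) := by
    intro s
    induction s with
    | zero =>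
      intro _
      have hD0 : ∀ c : PBond P 0, D 0 c = 0 := fun c => by
        rw [hD_def]
        show ((Averaging.iter (fun i => blockAvg (P := P) (j := i) (expMeanLogSU (n := n))) 0 U c : Matrix.specialUnitaryGroup n ℂ) :
            Matrix n n ℂ) - 1 - Q 0 Y c = 0
        rw [iter_zero_apply', hQ0, sub_self]
      refine ⟨fun c => by rw [hD0, norm_zero]; positivity, fun φ _ => ⟨fun _ => 0, fun _ => 0, fun b => ?_, fun b => ?_, fun y => ?_⟩⟩
      · rw [hD0, map_zero]; simp [dgrad]
      · simp only [abs_zero]; positivity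
      · simp only [abs_zero]; positivity
    | succ s ih =>
      intro hsk
      have hs : s ≤ k := (Nat.le_succ s).trans hsk
      obtain ⟨ihN, ihφ⟩ := ih hs
      -- sizes at level `s`
      have hCm : C * m s ≤ 1 := (mul_le_mul_of_nonneg_left (hmono s hs) hC0).trans (by rw [hC]; exact hm)
      have hDm : C * (m s) ^ 2 ≤ m s := by
        have : C * (m s) ^ 2 = (C * m s) * m s := by ring
        rw [this]; exact (mul_le_mul_of_nonneg_right hCm (hm0 s)).trans_eq (one_mul _)
      have hW1 : ∀ b, ‖((W s b : Matrix.specialUnitaryGroup n ℂ) : Matrix n n ℂ) - 1‖ ≤ 2 * m s := fun b => by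
        have e : ((W s b : Matrix.specialUnitaryGroup n ℂ) : Matrix n n ℂ) - 1 = Q s Y b + D s b := by rw [hD_def]; abel
        rw [e]
        exact (norm_add_le _ _).trans (by linarith [hmain s b, ihN b, hDm])
      -- the one-step hypotheses at scale `2 m_s`
      have h2m0 : 0 ≤ 2 * m s := by linarith [hm0 s]
      have hCℓ : 32 * ℓ ≤ C := by
        rw [hC]
        have hn1 : (1 : ℝ) ≤ (Fintype.card n : ℝ) := by exact_mod_cast Fintype.card_pos
        have hℓ1 : 1 ≤ ℓ := by rw [hℓeq]; nlinarith
        nlinarith [mul_nonneg hℓ0 hd0, sq_nonneg ((Fintype.card n : ℝ)), mul_le_mul hn1 hn1 zero_le_one (zero_le_one.trans hn1)]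
      have h16 : 16 * (ℓ * (2 * m s)) ≤ 1 := by
        have h2 : 16 * (ℓ * (2 * m s)) = (32 * ℓ) * m s := by ring
        rw [h2]
        exact (mul_le_mul_of_nonneg_right hCℓ (hm0 s)).trans hCm
      have hNs : 2 * (ℓ * (2 * m s)) < deltaSU n := by
        have : 2 * (ℓ * (2 * m s)) ≤ 4 * ℓ * m k := by nlinarith [hmono s hs, hℓ0]
        exact this.trans_lt hN
      have hone := norm_avgFun_sub_one_sub_linAvg_le (n := n) (W s) h2m0 hW1 h16 hNs
      -- the one-step error and the remainder recursion `D_{s+1} = E + Q₁ D_s`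
      let E : PBond P (s + 1) → Matrix n n ℂ := fun c =>
        ((avgFun (expMeanLogSU (n := n)) (W s) c : Matrix.specialUnitaryGroup n ℂ) : Matrix n n ℂ) - 1 -
          linAvg (fun b => ((W s b : Matrix.specialUnitaryGroup n ℂ) : Matrix n n ℂ) - 1) c
      have hE : ∀ c, ‖E c‖ ≤ 324 * ℓ ^ 2 * (m s) ^ 2 := fun c =>
        (hone c).trans_eq (by ring)
      have hrec : ∀ c, D (s + 1) c = E c + linAvg (D s) c := fun c => by
        have hsplit : linAvg (fun b => ((W s b : Matrix.specialUnitaryGroup n ℂ) : Matrix n n ℂ) - 1) c = Q (s + 1) Y c + linAvg (D s) c := by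
          have e : (fun b => ((W s b : Matrix.specialUnitaryGroup n ℂ) : Matrix n n ℂ) - 1) = fun b => Q s Y b + D s b := by
            funext b; rw [hD_def]; abel
          rw [e, linAvg_add, hQs]
        rw [hD_def]
        show ((Averaging.iter (fun i => blockAvg (P := P) (j := i) (expMeanLogSU (n := n))) (s + 1) U c : Matrix.specialUnitaryGroup n ℂ) :
            Matrix n n ℂ) - 1 - Q (s + 1) Y c = E c + linAvg (D s) c
        rw [iter_succ_eq_avgFun']
        show ((avgFun (expMeanLogSU (n := n)) (W s) c : Matrix.specialUnitaryGroup n ℂ) : Matrix n n ℂ) - 1 - Q (s + 1) Y c = E c + linAvg (D s) c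
        have : Q (s + 1) Y c = linAvg (fun b => ((W s b : Matrix.specialUnitaryGroup n ℂ) : Matrix n n ℂ) - 1) c - linAvg (D s) c := by
          rw [hsplit]; abel
        rw [this]
        show _ = (((avgFun (expMeanLogSU (n := n)) (W s) c : Matrix.specialUnitaryGroup n ℂ) : Matrix n n ℂ) - 1 -
          linAvg (fun b => ((W s b : Matrix.specialUnitaryGroup n ℂ) : Matrix n n ℂ) - 1) c) + linAvg (D s) c
        abel
      -- potential form of every bounded real coordinate at level `s + 1`
      have hpot : ∀ (φ : Matrix n n ℂ →ₗ[ℝ] ℝ), (∀ M : Matrix n n ℂ, |φ M| ≤ ‖M‖) →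
          ∃ (S : PBond P (s + 1) → ℝ) (Φ : Site P (s + 1) → ℝ),
            (∀ b, φ (D (s + 1) b) = S b - dgrad Φ b) ∧ (∀ b, |S b| ≤ A * (m (s + 1)) ^ 2) ∧ (∀ y, |Φ y| ≤ B * (m (s + 1)) ^ 2) := by
        intro φ hφ
        obtain ⟨S, Φ, hid, hS, hΦ⟩ := ihφ φ hφ
        -- the real coordinate of the old remainder, as a function
        have hidf : (fun b => φ (D s b)) = fun b => S b - dgrad Φ b := funext hid
        have hdφ : ∀ b, |φ (D s b)| ≤ A * (m s) ^ 2 + 2 * (B * (m s) ^ 2) := fun b => by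
          rw [hid]
          exact (abs_sub _ _).trans (add_le_add (hS b) (abs_dgrad_le Φ hΦ b))
        refine ⟨fun c => segMean S c + φ (E c), fun y => ptMean Φ y + stairMean (fun b => φ (D s b)) y, fun c => ?_, fun c => ?_, fun y => ?_⟩
        · -- the identity: `φ(D_{s+1} c) = φ(E c) + Q₁(φ∘D_s)(c)` and `Q₁ = M − d∘(ptMean, Φ)`
          rw [hrec, map_add, apply_linAvg, linAvg04_eq]
          have hseg : segMean (fun b => φ (D s b)) c = segMean S c - (ptMean Φ c.tgt - ptMean Φ c.src) := by
            rw [hidf, show (fun b => S b - dgrad Φ b) = S - dgrad Φ from rfl, segMean_sub, segMean_dgrad]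
          rw [hseg]
          simp only [dgrad]
          ring
        · calc |segMean S c + φ (E c)| ≤ |segMean S c| + |φ (E c)| := abs_add_le _ _
            _ ≤ (P.L : ℝ) * (A * (m s) ^ 2) + 324 * ℓ ^ 2 * (m s) ^ 2 := add_le_add (abs_segMean_le S hS c) ((hφ _).trans (hE c))
            _ ≤ A * ((P.L : ℝ) ^ 2 * (m s) ^ 2) := by rw [hA]; exact sigma_step hL2 (sq_nonneg _)
            _ = A * (m (s + 1)) ^ 2 := by rw [hmsq]
        · calc |ptMean Φ y + stairMean (fun b => φ (D s b)) y| ≤ |ptMean Φ y| + |stairMean (fun b => φ (D s b)) y| := abs_add_le _ _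
            _ ≤ B * (m s) ^ 2 + ((P.d * ((P.L - 1) / 2) : ℕ) : ℝ) * (A * (m s) ^ 2 + 2 * (B * (m s) ^ 2)) :=
                add_le_add (abs_ptMean_le Φ hΦ y) (abs_stairMean_le _ hdφ y)
            _ ≤ B * ((P.L : ℝ) ^ 2 * (m s) ^ 2) := by
                rw [hstair, hB, hA]; exact phi_step hL2 hd0 hdL (sq_nonneg _)
            _ = B * (m (s + 1)) ^ 2 := by rw [hmsq]
      refine ⟨fun c => ?_, hpot⟩
      -- the norm bound at level `s + 1` from the coordinates
      have hcoord : ∀ (φ : Matrix n n ℂ →ₗ[ℝ] ℝ), (∀ M : Matrix n n ℂ, |φ M| ≤ ‖M‖) → |φ (D (s + 1) c)| ≤ (A + 2 * B) * (m (s + 1)) ^ 2 := by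
        intro φ hφ
        obtain ⟨S, Φ, hid, hS, hΦ⟩ := hpot φ hφ
        rw [hid]
        calc |S c - dgrad Φ c| ≤ |S c| + |dgrad Φ c| := abs_sub _ _
          _ ≤ A * (m (s + 1)) ^ 2 + 2 * (B * (m (s + 1)) ^ 2) := add_le_add (hS c) (abs_dgrad_le Φ hΦ c)
          _ = (A + 2 * B) * (m (s + 1)) ^ 2 := by ring
      have hre : ∀ i l, |((D (s + 1) c) i l).re| ≤ (A + 2 * B) * (m (s + 1)) ^ 2 := fun i l => by
        have h := hcoord (Complex.reLm.comp (Matrix.entryLinearMap ℝ ℂ i l)) fun M => by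
          rw [reLm_comp_entry_apply]; exact (abs_re_im_entry_le_norm M i l).1
        rwa [reLm_comp_entry_apply] at h
      have him : ∀ i l, |((D (s + 1) c) i l).im| ≤ (A + 2 * B) * (m (s + 1)) ^ 2 := fun i l => by
        have h := hcoord (Complex.imLm.comp (Matrix.entryLinearMap ℝ ℂ i l)) fun M => by
          rw [imLm_comp_entry_apply]; exact (abs_re_im_entry_le_norm M i l).2
        rwa [imLm_comp_entry_apply] at h
      calc ‖D (s + 1) c‖ ≤ 2 * (Fintype.card n : ℝ) ^ 2 * ((A + 2 * B) * (m (s + 1)) ^ 2) := norm_le_of_coord_abs_le _ hre him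
        _ = C * (m (s + 1)) ^ 2 := by rw [hCAB]; ring
  -- assemble
  intro s hs c
  have h2 : ‖D s c‖ ≤ C * (m s) ^ 2 := (key s hs).1 c
  refine ⟨?_, by rw [hC] at h2; exact h2⟩
  have hCm : C * m s ≤ 1 := (mul_le_mul_of_nonneg_left (hmono s hs) hC0).trans (by rw [hC]; exact hm)
  have hDm : C * (m s) ^ 2 ≤ m s := by
    have : C * (m s) ^ 2 = (C * m s) * m s := by ring
    rw [this]; exact (mul_le_mul_of_nonneg_right hCm (hm0 s)).trans_eq (one_mul _)
  have e : ((W s c : Matrix.specialUnitaryGroup n ℂ) : Matrix n n ℂ) - 1 = Q s Y c + D s c := by rw [hD_def]; abel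
  show ‖((W s c : Matrix.specialUnitaryGroup n ℂ) : Matrix n n ℂ) - 1‖ ≤ 2 * m s
  rw [e]
  exact (norm_add_le _ _).trans (by linarith [hmain s c])

end Summit.QuantumFields.YangMills.Theorems.EMLIterUniform

end
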